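import Mathlib
import Summits.Ventures.HodgeRepro.Tier4.Target

/-!
# Tier4/Line3/LatticeGaussSummable — Gaussian weights on the integers of a number field are summable

Blind re-derivation cell `pub-hodge-repro`, Tier 4 «PROVE THE STEP», LINE L3, seat t4-x2 (g3, reserve wall-breaker); the
arithmetic of the pure count of bus S13913 (v0.44 `MajorantCount`): the copies of the centre are indexed by tuples of
algebraic integers, and their majorants are Gaussian in the archimedean sizes of the scalars.  Pure number theory on a
number field `E` (Mathlib only; no object of the line):
* `latPt x`: the point of the integer lattice `mixedEmbedding.integerLattice E` (a `ℤ`-lattice of the mixed space,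
  Mathlib) of an algebraic integer `x`; `latPt_injective`;
* `norm_emb_le_norm_mixed`: `‖σ x‖ ≤ ‖mixedEmbedding E x‖` for every complex embedding `σ` (the mixed norm is the sup
  over the infinite places = the HOUSE of `x`);
* **`summable_gauss_mixedNorm_sq`**: `Σ_{x ∈ 𝓞 E} exp(−c ‖mixedEmbedding E x‖²) < ∞` for every `c > 0` — the Gaussian is
  dominated by `(n!/cⁿ) · ‖z‖^{−2n}` away from `0` (`Real.pow_div_factorial_le_exp`) and `Σ_{z ∈ L} ‖z‖^{−2n}` converges on a
  `ℤ`-lattice of rank `d` for `2n > d` (`ZLattice.summable_norm_rpow`);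
* `summable_of_le_gauss`: any non-negative weight dominated by such a Gaussian is summable;
* `summable_prod_fin`: products of summable non-negative weights over `Fin n`-tuples are summable (`Fin.consEquiv`,
  `summable_mul_of_summable_norm`); `summable_gauss_mixedNorm_sq_tuple` is the 4-slot Gaussian.

Nothing here says anything about the status of the Hodge conjecture for CM abelian varieties, which is NOT proved
(HC_CM is NOT proved by anyone in this repository).
-/

set_option autoImplicit false

noncomputable section

namespace Summit.Ventures.HodgeRepro.Tier4.Line3

open NumberField NumberField.mixedEmbedding Filter
open scoped Classical

variable {E : Type} [Field E] [NumberField E]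

/-- The point of the integer lattice attached to an algebraic integer. -/
def latPt (x : 𝓞 E) : mixedEmbedding.integerLattice E :=
  ⟨mixedEmbedding E (x : E), LinearMap.mem_range.2 ⟨x, rfl⟩⟩

omit [NumberField E] in
/-- The lattice point of `x` is `mixedEmbedding E x`. -/
@[simp]
theorem latPt_coe (x : 𝓞 E) : (latPt x : mixedSpace E) = mixedEmbedding E (x : E) := rfl

/-- `latPt` is injective. -/
theorem latPt_injective : Function.Injective (latPt (E := E)) := by
  intro x y h
  have h1 : mixedEmbedding E (x : E) = mixedEmbedding E (y : E) := by
    have := congrArg (fun z : mixedEmbedding.integerLattice E => (z : mixedSpace E)) h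
    simpa using this
  exact RingOfIntegers.ext (mixedEmbedding_injective E h1)

/-- Every complex embedding is bounded by the mixed norm: `‖σ x‖ ≤ ‖mixedEmbedding E x‖`. -/
theorem norm_emb_le_norm_mixed (x : E) (σ : E →+* ℂ) : ‖σ x‖ ≤ ‖mixedEmbedding E x‖ := by
  classical
  rw [norm_eq_sup'_normAtPlace]
  have h : ‖σ x‖ = normAtPlace (InfinitePlace.mk σ) (mixedEmbedding E x) := by
    rw [normAtPlace_apply, InfinitePlace.apply]
  rw [h]
  exact Finset.le_sup' (fun w => normAtPlace w (mixedEmbedding E x)) (Finset.mem_univ (InfinitePlace.mk σ))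

/-- The Gaussian is dominated by an inverse power: `exp(−c t²) ≤ (n! / cⁿ) · (t ^ (2n))⁻¹` for `t > 0`, `c > 0`. -/
theorem exp_neg_mul_sq_le_inv_pow {c t : ℝ} (hc : 0 < c) (ht : 0 < t) (n : ℕ) :
    Real.exp (-(c * t ^ 2)) ≤ ((n.factorial : ℝ) / c ^ n) * (t ^ (2 * n))⁻¹ := by
  have hx : 0 ≤ c * t ^ 2 := by positivity
  have h1 := Real.pow_div_factorial_le_exp _ hx n
  have hpos : 0 < (c * t ^ 2) ^ n / (n.factorial : ℝ) := by positivity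
  rw [Real.exp_neg]
  calc (Real.exp (c * t ^ 2))⁻¹ ≤ ((c * t ^ 2) ^ n / (n.factorial : ℝ))⁻¹ := inv_anti₀ hpos h1
    _ = ((n.factorial : ℝ) / c ^ n) * (t ^ (2 * n))⁻¹ := by
        rw [mul_pow, ← pow_mul]
        field_simp

/-- **GAUSSIAN WEIGHTS ON THE INTEGER LATTICE ARE SUMMABLE**: `Σ_{x ∈ 𝓞 E} exp(−c ‖mixedEmbedding E x‖²) < ∞` for `c > 0`. -/
theorem summable_gauss_mixedNorm_sq {c : ℝ} (hc : 0 < c) :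
    Summable fun x : 𝓞 E => Real.exp (-(c * ‖mixedEmbedding E (x : E)‖ ^ 2)) := by
  classical
  set L : Submodule ℤ (mixedSpace E) := mixedEmbedding.integerLattice E with hL
  set n : ℕ := Module.finrank ℤ L + 1 with hn
  have hr : (-(2 * n : ℕ) : ℝ) < -(Module.finrank ℤ L : ℝ) := by
    rw [hn]
    push_cast
    linarith
  have hsum : Summable fun z : L => ‖z‖ ^ (-(2 * n : ℕ) : ℝ) := ZLattice.summable_norm_rpow L _ hr
  have hsumC : Summable fun z : L => ((n.factorial : ℝ) / c ^ n) * ‖z‖ ^ (-(2 * n : ℕ) : ℝ) := hsum.mul_left _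
  -- the Gaussian on the lattice
  have hgauss : Summable fun z : L => Real.exp (-(c * ‖z‖ ^ 2)) := by
    refine Summable.of_norm_bounded_eventually hsumC ?_
    refine Filter.eventually_cofinite.2 ((Set.finite_singleton (0 : L)).subset fun z hz => ?_)
    simp only [Set.mem_setOf_eq] at hz
    by_contra hz0
    apply hz
    have hzpos : 0 < ‖z‖ := norm_pos_iff.2 hz0
    rw [Real.norm_of_nonneg (Real.exp_pos _).le, Real.rpow_neg (norm_nonneg _), Real.rpow_natCast]
    exact exp_neg_mul_sq_le_inv_pow hc hzpos n
  -- transfer along the injection `latPt`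
  have := hgauss.comp_injective (latPt_injective (E := E))
  exact this.congr fun x => rfl

/-- A non-negative weight dominated by a Gaussian in the mixed norm is summable over `𝓞 E`. -/
theorem summable_of_le_gauss {w : 𝓞 E → ℝ} (hw0 : ∀ x, 0 ≤ w x) {C c : ℝ} (hc : 0 < c)
    (hw : ∀ x, w x ≤ C * Real.exp (-(c * ‖mixedEmbedding E (x : E)‖ ^ 2))) : Summable w :=
  Summable.of_nonneg_of_le hw0 hw ((summable_gauss_mixedNorm_sq hc).mul_left C)

/-- Products of a summable non-negative weight over `Fin n`-tuples are summable. -/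
theorem summable_prod_fin {X : Type} {g : X → ℝ} (hg0 : ∀ x, 0 ≤ g x) (hg : Summable g) :
    ∀ n : ℕ, Summable fun ε : Fin n → X => ∏ j, g (ε j) := by
  intro n
  induction n with
  | zero => exact Summable.of_finite
  | succ n ih =>
    have hmul : Summable fun p : X × (Fin n → X) => g p.1 * ∏ j, g (p.2 j) := by
      refine summable_mul_of_summable_norm (f := g) (g := fun ε : Fin n → X => ∏ j, g (ε j)) ?_ ?_
      · exact hg.congr fun x => (Real.norm_of_nonneg (hg0 x)).symm
      · exact ih.congr fun ε => (Real.norm_of_nonneg (Finset.prod_nonneg fun j _ => hg0 _)).symm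
    rw [← (Fin.consEquiv fun _ => X).summable_iff]
    refine hmul.congr fun p => ?_
    simp only [Function.comp_apply, Fin.consEquiv_apply, Fin.prod_univ_succ, Fin.cons_zero, Fin.cons_succ]

/-- The 4-slot Gaussian `exp(−c Σ_j ‖mixedEmbedding E ε_j‖²)` is summable over `Fin 4 → 𝓞 E`. -/
theorem summable_gauss_mixedNorm_sq_tuple {c : ℝ} (hc : 0 < c) :
    Summable fun ε : Fin 4 → 𝓞 E => Real.exp (-(c * ∑ j, ‖mixedEmbedding E (ε j : E)‖ ^ 2)) := by
  have h := summable_prod_fin (g := fun x : 𝓞 E => Real.exp (-(c * ‖mixedEmbedding E (x : E)‖ ^ 2)))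
    (fun _ => (Real.exp_pos _).le) (summable_gauss_mixedNorm_sq hc) 4
  refine h.congr fun ε => ?_
  rw [← Real.exp_sum, Finset.mul_sum, ← Finset.sum_neg_distrib]

end Summit.Ventures.HodgeRepro.Tier4.Line3

end
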